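import Summits.Ventures.HSemireg.MarkmanClassStatementComponent
import Summits.HodgeConjecture.HodgeConjecture.Theorems.WeilTypeLadderDegenerationUp
import HarnessLib

/-!
# Venture HSemireg — Markman's class statement UNIFORM IN THE LEVEL `n = dim X`: what the strategy of [Mar25b] §4, implemented at
# level `4` for every `K`, resp. at unboundedly many levels, gives on the tree's Weil ladder (R2₈, R1 = stmt-2524, R1′, R2, R∞, dim ≤ 5)

HONEST FRAMING. Lean index of the computation cell `pub-hsemireg` (seat p5); proof-only companion of `MarkmanClassStatement.lean`
(pointwise statement), `MarkmanKappaShape.lean` (class-side predicate), `MarkmanClassStatementAssembly.lean` (split component, ONE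
level) and `MarkmanClassStatementComponent.lean` (any component; §5 there: one level down). Nothing about any explicit variety is
asserted; every published input is a hypothesis BY NAME (`weilFamilyReach_hyperbolic`, the assembly's `LocalVariationalHodgeFor 𝒪`,
p4's ASSUMPTION `PerfectComplexRankTransfer C`, the Moonen–Zarhin reduction) or BY VALUE (a hyperbolic seed of class `𝒪` per level
and field = the census's object rows; in §3 the anchor, κ-shape and object clause unbundled). NOTHING below is a theorem in print:
for `n = dim X ≥ 4` the strategy has no printed instance ([Mar25b] §11 «we are currently able to handle it only for `dim(X) ≤ 3`»,
§12 «yet to be checked»), and no census row of the cell currently supplies a level-`≥ 4` object. Every declaration is an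
IMPLICATION recording which rung of the tree's ladder `Theorems/WeilTypeLadder.lean` such objects WOULD settle; nothing here says that
HC, HC_CM or HC_AV is proved, and the terminus of this file is R∞ / HC(dim ≤ 5), NOT `HC_AV` (§4). 0 `sorry`, 0 definitions, 0 new
named facts.

## The printed sentences read uniformly in the level ([Mar25b] = arXiv:2509.23403; «p. N, lines a–b» = PDF page of the arXiv
## text, the same page in v1 and v2, lines of the v2 text layer; bracketed references as the PDF prints them — this file's first
## version gave the held corpus chunk numbers «p. 19» / «p. 20» for §11.5 / §12, both of which are printed on p. 21)

* §4 (p. 9, lines 16–17 and 33–36): «Assume that the abelian `n`-fold `X` admits …», «establish the algebraicity of the Weil classes on `X×X̂`, and use the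
  Semi-regularity theorem to deform them to all abelian varieties of Weil type in the same connected component in moduli.» — the
  strategy is stated for every `n`; its class side at level `N` is the assembly's `HasHyperbolicSeedOn 𝒪 N d` (= anchor ∧
  `IsMarkmanKappaShape` ∧ object clause: `hasHyperbolicSeedOn_iff_exists_isMarkmanKappaShape`).
* §11.5 Step 1 (p. 21, lines 30–35): «Two connected components of the moduli space of polarized abelian varieties of Weil type of dimension `2n`,
  the same imaginary quadratic number field, and the same discriminant, parametrize isogenous abelian varieties [vG, Th. 5.2(3)]. The
  discriminant … is the coset of `(-1)ⁿ` if and only if the component parametrizes polarized abelian varieties of split Weil type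
  [DM, Cor. 4.2].» — ONE split anchor per `(N, K)` covers the split `2N`-folds: `Stubs.WeilAlgebraicSplitHyperplane N d`
  (`splitHyperplane_of_reach_of_localVariationalHodgeFor_of_hyperbolicSeedOn`, landed).
* §11.5 Step 2 (p. 21, lines 37–48): «The discriminant invariant … is multiplicative under cartesian products. Every value in `ℚ^×/Nm_{K/ℚ}(K^×)` is
  realized as the discriminant by some connected component of moduli in every even dimension [vG, Th. 5.2]. Hence, for every polarized
  abelian fourfold `(A₁,η₁,h₁)` of Weil type, of arbitrary discriminant, there exists a polarized abelian surface of Weil type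
  `(A₂,η₂,h₂)`, such that the discriminant of their product … is the coset of `-1`. The sixfold is hence of split type and so its Weil
  classes are algebraic. It follows that the Weil classes of `(A₁,η₁,h₁)` are algebraic, by [S2, Prop. 10].» — printed for `6 → 4`; the
  tree PROVES the step in every dimension (`stub_descend`, Schoen 1998 §10) and iterates it (`weilAlgebraicAll_of_splitHyperplane_lt`).
* §12 (p. 21, lines 51–54; the question is the section's title): «What about Weil classes on abelian varieties of dimension `≥ 8`?
  We expect that an affirmative answer to Question 11.4 would lead to a proof of the algebraicity of Weil classes on some higher dimensional abelian varieties, as well as for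
  CM-fields `K` with `[K:ℚ]>2`, using the strategy outlined in Section 4.» — an EXPECTATION, not a theorem; the tree's rungs R2₈
  `SplitEightfolds`, R2 `SplitWeilAbelianVarieties`, R∞ `WeilClassesImaginaryQuadratic` carry `[status: open]`.
* Thm. 1.2 / Cor. 1.3 (p. 3, lines 20–22 and 46–47): «[M2, Theorem 1.5.1] The Weil classes for abelian fourfolds of Weil type and abelian sixfolds of split Weil type with
  complex multiplication by a quadratic imaginary number field `K` are algebraic.» «Combining these results [gloss: [MZ1, MZ2], [R], [Ta] of the
  preceding sentences] with Theorem 1.2 we get: Corollary 1.3. The Hodge conjecture holds for abelian varieties of dimension `≤ 5`.» — §4 below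
  renders the combination with the reduction as the NAMED FACT `MoonenZarhin1999_hodgeClasses_abelian_dim_le_five_of_weilClassesFourfolds`.

## Contents (every theorem a composition of landed tree theorems; the joint is p7's
`hasLocallyAlgebraicWeilAnchor_of_localVariationalHodgeFor_of_hyperbolicSeedOn` = «door + seed ⟹ the ladder's LOCAL ANCHOR»)

§1 LEVEL 4 for every `K` (the cell's `g = 8` rows, were one to pass on a SPLIT anchor for every `d`): R2₈ `SplitEightfolds`, R1 =
item stmt-HodgeConjecture-2524 `SevenfoldWeilCensus.WeilSixfolds` (EVERY sixfold, every discriminant — the NON-SPLIT sixfold rows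
included), R1′ `NonsplitSixfolds`; per `K`: `WeilAlgebraicAll 3 d` and every sixfold cell `WeilClassesComponent 3 d δ`.
§2 ALL LEVELS: `n ≥ 4` for every `d` ⟹ R2 `SplitWeilAbelianVarieties` and R∞ `WeilClassesImaginaryQuadratic` (Weil 1977's question for
imaginary quadratic `K`; = stmt-HodgeConjecture-2522 over `weilClassesOf`); COFINAL levels suffice; per-`K` column; §2b the
reading on a Weil-type member (the whole Weil plane `weilClassesOf A φ n d ≤ algebraicClasses A.X n`, no polarization binder).
§3 the same in p5's κ-shape currency (anchor in Markman's polarization, `IsMarkmanKappaShape`, object clause — ONE anchor per `d`) and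
on route (C)'s real carriers (`PerfectComplexRankTransfer C` BY NAME).
§4 the honest terminus: R∞ ⟹ Markman's fourfold statement F1 and, granted the Moonen–Zarhin reduction BY NAME, HC for abelian varieties
of dimension `≤ 5` ([Mar25b] Cor. 1.3 AS PRINTED, as an implication); NOT `HC_AV` (ring 2: `HodgeWeilType ↔ HC_AV` needs ALL Hodge
classes of ALL Weil-type members; the CM-field rung `WeilClassesCMField` has no descent edge in the tree).

References: [Markman2025SurveySecant] arXiv:2509.23403 §4, §11.5, §12, Thm. 1.2, Cor. 1.3 — a SURVEY, published: Proc. ICM 2026 Vol. 3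
(SIAM, 2026) pp. 586–602, bib `Markman2026ICMSecant` (SIAM pagination/numbering not verified against the arXiv text quoted here); the
RESULTS it reports (Thm. 1.2, Cor. 1.3, the §11.5 sketch) are proved in [Markman2025SecantWeil], a PREPRINT; [Markman2025SecantWeil]
arXiv:2502.03415 §1.2, §1.6 (preprint); [Schoen1998HodgeWeilAddendum] §10; [Deligne1982HodgeCycles] proof of Thm. 4.8;
[vanGeemen1994HodgeAV] 5.2–5.4; [Weil1977HodgeRing] §3; [MoonenZarhin1999LowDim] Thms. 0.1–0.2; [BuchweitzFlenner2008HH] Prop. 6.4.4;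
[WeilLocusSixfolds2026] arXiv:2603.20268 p. 3 (status of the sixfold case; preprint).
-/

noncomputable section

open CategoryTheory AlgebraicGeometry

namespace Summit.Ventures.HSemireg

open Literature.AlgebraicGeometry Literature.AlgebraicGeometry.Motives
open Literature.AlgebraicGeometry.HodgeTheory
open Literature.AlgebraicGeometry.VanGeemen1994
open Literature.AlgebraicTopology.SingularHomology
open Summit.HodgeConjecture.HodgeConjecture
open Summit.HodgeConjecture.HodgeConjecture.WeilTypeLadder
open Summit.HodgeConjecture.HodgeConjecture.Ring2.Hypotheses
open Summit.HodgeConjecture.HodgeConjecture.Cruxes.HodgeAbelianVarieties.EStepSecantInduction (WeilAlgebraicAll)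

/-! ## §1 Level 4 for every `K`: the first rungs above print (R2₈, R1 = stmt-2524, R1′) -/

section LevelFour

variable {𝒪 : ObjClass}

/-- **R2₈ `SplitEightfolds` ⟸ hyperbolic reach ∧ `LocalVariationalHodgeFor 𝒪` ∧ ONE hyperbolic seed of class `𝒪` on a split
`ℚ(√-d)`-Weil EIGHTFOLD for every `d`** ([Mar25b] §4 at `n = dim X = 4`, §11.5 Step 1 one dimension up; §12 «dimension ≥ 8» is an
expectation in print — nothing claimed). The ladder's `splitEightfolds_of_reach_of_localAnchor` on p7's local anchor.
[cite: Markman2025SurveySecant, §4, §11.5 Step 1 and §12 (preprint)] [cite: Markman2025SecantWeil, §1.2 (preprint)]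
[cite: Deligne1982HodgeCycles, proof of Thm. 4.8] -/
theorem splitEightfolds_of_reach_of_localVariationalHodgeFor_of_hyperbolicSeedsOn_four (hF : weilFamilyReach_hyperbolic)
    (hT : LocalVariationalHodgeFor 𝒪) (hS : ∀ d : ℕ, 0 < d → HasHyperbolicSeedOn 𝒪 4 d) : SplitEightfolds :=
  splitEightfolds_of_reach_of_localAnchor hF fun d hd ↦
    hasLocallyAlgebraicWeilAnchor_of_localVariationalHodgeFor_of_hyperbolicSeedOn hT (hS d hd)

/-- **R1 = item stmt-HodgeConjecture-2524 `SevenfoldWeilCensus.WeilSixfolds` (the Hodge–Weil classes of EVERY `√-d`-Weil abelian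
sixfold, every `d`, EVERY discriminant — the cell's non-split sixfold rows included) ⟸ the same level-4 hypotheses**: R2₈ then the
tree's unconditional degeneration edge `weilSixfolds_of_splitEightfolds` ([Mar25b] §11.5 Step 2 one dimension up; Schoen §10 PROVED in
the tree). In print: «outside this locus [discriminant `-1`], the Hodge conjecture for Weil classes on sixfolds remains completely open»
(arXiv:2603.20268 p. 3); an implication only. [cite: Markman2025SurveySecant, §11.5 Step 2 (preprint)] [cite: WeilLocusSixfolds2026, p. 3 (status; preprint)]
[cite: Schoen1998HodgeWeilAddendum, §10] [cite: Deligne1982HodgeCycles, proof of Thm. 4.8] -/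
theorem weilSixfolds_of_reach_of_localVariationalHodgeFor_of_hyperbolicSeedsOn_four (hF : weilFamilyReach_hyperbolic)
    (hT : LocalVariationalHodgeFor 𝒪) (hS : ∀ d : ℕ, 0 < d → HasHyperbolicSeedOn 𝒪 4 d) :
    Theses.SevenfoldWeilCensus.WeilSixfolds :=
  weilSixfolds_of_reach_of_localAnchor_four hF fun d hd ↦
    hasLocallyAlgebraicWeilAnchor_of_localVariationalHodgeFor_of_hyperbolicSeedOn hT (hS d hd)

/-- **R1′ `NonsplitSixfolds` (Weil classes on the GENERAL member of every NON-split sixfold component — the cell's DECIDING `g = 6`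
rows) ⟸ the same level-4 hypotheses**: no non-split anchor is needed for the non-split sixfold rung, a SPLIT eightfold object for
every `K` would do. OPEN in print for the general member of every non-split component; an implication only.
[cite: Markman2025SurveySecant, §11.5 Steps 1–2 and §12 (preprint)] [cite: WeilLocusSixfolds2026, p. 3 (status; preprint)]
[cite: Schoen1998HodgeWeilAddendum, §10] [cite: Deligne1982HodgeCycles, proof of Thm. 4.8] -/
theorem nonsplitSixfolds_of_reach_of_localVariationalHodgeFor_of_hyperbolicSeedsOn_four (hF : weilFamilyReach_hyperbolic)
    (hT : LocalVariationalHodgeFor 𝒪) (hS : ∀ d : ℕ, 0 < d → HasHyperbolicSeedOn 𝒪 4 d) : NonsplitSixfolds :=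
  nonsplitSixfolds_of_reach_of_localAnchor_four hF fun d hd ↦
    hasLocallyAlgebraicWeilAnchor_of_localVariationalHodgeFor_of_hyperbolicSeedOn hT (hS d hd)

/-- **Per `K = ℚ(√-d)`: ONE level-4 seed for `d` ⟹ `WeilAlgebraicAll 3 d`** — the Weil classes of EVERY `√-d`-Weil abelian sixfold,
split and non-split alike (instance `N = 4`, `n = 3` of the assembly's `…_hyperbolicSeedOn_lt`). [cite: Markman2025SurveySecant, §11.5 Step 2 (preprint)]
[cite: Schoen1998HodgeWeilAddendum, §10] -/
theorem weilAlgebraicAll_three_of_reach_of_localVariationalHodgeFor_of_hyperbolicSeedOn_four (hF : weilFamilyReach_hyperbolic)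
    (hT : LocalVariationalHodgeFor 𝒪) {d : ℕ} (hd : 0 < d) (hS : HasHyperbolicSeedOn 𝒪 4 d) : WeilAlgebraicAll 3 d :=
  weilAlgebraicAll_of_localVariationalHodgeFor_of_hyperbolicSeedOn_lt hF hT hS (by norm_num) (by norm_num) hd

/-- **… hence every sixfold CELL `(3, K = ℚ(√-d), δ)` of that `K`** (`WeilClassesComponent 3 d δ`, the census's row currency; the
non-split cells `δ ≠ [-1]` are the cell's deciding rows — NOTHING in print there; an implication from a level-4 object only).
[cite: Markman2025SurveySecant, §11.5 Step 2 (preprint)] [cite: Markman2025SecantWeil, §1.1 (the invariant (n, K, det H); preprint)]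
[cite: vanGeemen1994HodgeAV, 4.14 and Lemma 5.2] -/
theorem weilSixfoldComponent_of_reach_of_localVariationalHodgeFor_of_hyperbolicSeedOn_four (hF : weilFamilyReach_hyperbolic)
    (hT : LocalVariationalHodgeFor 𝒪) {d : ℕ} (hd : 0 < d) (hS : HasHyperbolicSeedOn 𝒪 4 d) (δ : weilNormResidueGroup d) :
    WeilClassesComponent 3 d δ :=
  weilClassesComponent_of_weilAlgebraicAll
    (weilAlgebraicAll_three_of_reach_of_localVariationalHodgeFor_of_hyperbolicSeedOn_four hF hT hd hS) δ

end LevelFour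

/-! ## §2 All levels: R2 and R∞ ([Mar25b] §4 read for every `n = dim X`; §12) -/

section AllLevels

variable {𝒪 : ObjClass}

/-- **R2 `SplitWeilAbelianVarieties` (split `ℚ(√-d)`-Weil `2n`-folds, every `n ≥ 4`, every `d`) ⟸ hyperbolic reach ∧
`LocalVariationalHodgeFor 𝒪` ∧ ONE hyperbolic seed of class `𝒪` at EVERY level `n ≥ 4` for every `d`** ([Mar25b] §4 + §11.5 Step 1
at every `n`; §12: an expectation in print). [cite: Markman2025SurveySecant, §4, §11.5 Step 1 and §12 (preprint)]
[cite: Deligne1982HodgeCycles, proof of Thm. 4.8] -/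
theorem splitWeilAbelianVarieties_of_reach_of_localVariationalHodgeFor_of_hyperbolicSeedsOn (hF : weilFamilyReach_hyperbolic)
    (hT : LocalVariationalHodgeFor 𝒪) (hS : ∀ n : ℕ, 4 ≤ n → ∀ d : ℕ, 0 < d → HasHyperbolicSeedOn 𝒪 n d) :
    SplitWeilAbelianVarieties :=
  splitWeilAbelianVarieties_of_reach_of_localAnchor hF fun n hn d hd ↦
    hasLocallyAlgebraicWeilAnchor_of_localVariationalHodgeFor_of_hyperbolicSeedOn hT (hS n hn d hd)

/-- **R∞ `WeilClassesImaginaryQuadratic` — Weil's question for imaginary quadratic `K` (Weil classes algebraic on EVERY `ℚ(√-d)`-Weil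
abelian `2n`-fold, `n ≥ 2`, every `d`, every discriminant) ⟸ hyperbolic reach ∧ `LocalVariationalHodgeFor 𝒪` ∧ COFINAL seed levels:
for every `n ≥ 2` and `d` SOME level `N > n` carries a hyperbolic seed of class `𝒪` for `ℚ(√-d)`** (descent `stub_descend` iterated,
same `d`; no floor fact). The honest terminus of the strategy read uniformly in the level; NOT `HC_AV` (§4).
[cite: Markman2025SurveySecant, §4, §11.5 Steps 1–2 and §12 (preprint)] [cite: Weil1977HodgeRing, §3] [cite: Schoen1998HodgeWeilAddendum, §10]
[cite: Markman2026ICMSecant, §4, §11.5 and §12 of the arXiv text (published ICM 2026 survey reporting it; proof = Markman2025SecantWeil, preprint)]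
[cite: Deligne1982HodgeCycles, proof of Thm. 4.8] -/
theorem weilClassesImaginaryQuadratic_of_reach_of_localVariationalHodgeFor_of_cofinalHyperbolicSeedsOn
    (hF : weilFamilyReach_hyperbolic) (hT : LocalVariationalHodgeFor 𝒪)
    (hS : ∀ n : ℕ, 2 ≤ n → ∀ d : ℕ, 0 < d → ∃ N : ℕ, n < N ∧ HasHyperbolicSeedOn 𝒪 N d) :
    WeilClassesImaginaryQuadratic := by
  intro n hn d hd A φ hA _ hφ c hc hnn hcW
  obtain ⟨N, hnN, hSN⟩ := hS n hn d hd
  exact weilAlgebraicAll_of_localVariationalHodgeFor_of_hyperbolicSeedOn_lt hF hT hSN hn hnN hd A φ hA hφ c hcW hc hnn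

/-- **R∞ ⟸ … ∧ a hyperbolic seed of class `𝒪` at EVERY level `N ≥ 4` for every `d`** (levels `≥ 4` are cofinal; level `4` already
covers `n = 2, 3`). [cite: Markman2025SurveySecant, §4 and §12 (preprint)] [cite: Schoen1998HodgeWeilAddendum, §10] -/
theorem weilClassesImaginaryQuadratic_of_reach_of_localVariationalHodgeFor_of_hyperbolicSeedsOn_ge_four
    (hF : weilFamilyReach_hyperbolic) (hT : LocalVariationalHodgeFor 𝒪)
    (hS : ∀ N : ℕ, 4 ≤ N → ∀ d : ℕ, 0 < d → HasHyperbolicSeedOn 𝒪 N d) : WeilClassesImaginaryQuadratic :=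
  weilClassesImaginaryQuadratic_of_reach_of_localVariationalHodgeFor_of_cofinalHyperbolicSeedsOn hF hT fun n hn d hd ↦
    ⟨n + 2, by omega, hS (n + 2) (by omega) d hd⟩

/-- **One column `K = ℚ(√-d)`** (what ONE census column gives — e.g. a family `E_n` passing on the split CM anchor `E_K^{2N}` at cofinal
levels `N`, for this `K` only): `WeilAlgebraicAll n d` for EVERY `n ≥ 2` (every discriminant). [cite: Markman2025SurveySecant, §4 and §11.5 Step 2 (preprint)]
[cite: Schoen1998HodgeWeilAddendum, §10] -/
theorem weilAlgebraicAll_of_reach_of_localVariationalHodgeFor_of_cofinalHyperbolicSeedsOn_column (hF : weilFamilyReach_hyperbolic)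
    (hT : LocalVariationalHodgeFor 𝒪) {d : ℕ} (hd : 0 < d) (hS : ∀ n : ℕ, 2 ≤ n → ∃ N : ℕ, n < N ∧ HasHyperbolicSeedOn 𝒪 N d)
    {n : ℕ} (hn : 2 ≤ n) : WeilAlgebraicAll n d := by
  obtain ⟨N, hnN, hSN⟩ := hS n hn
  exact weilAlgebraicAll_of_localVariationalHodgeFor_of_hyperbolicSeedOn_lt hF hT hSN hn hnN hd

/-- **… hence every CELL `(n, K = ℚ(√-d), δ)`, `n ≥ 2`, of that column.** [cite: Markman2025SecantWeil, §1.1 (the invariant (n, K, det H); preprint)]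
[cite: vanGeemen1994HodgeAV, 4.14 and Lemma 5.2] -/
theorem weilClassesComponent_of_reach_of_localVariationalHodgeFor_of_cofinalHyperbolicSeedsOn_column
    (hF : weilFamilyReach_hyperbolic) (hT : LocalVariationalHodgeFor 𝒪) {d : ℕ} (hd : 0 < d)
    (hS : ∀ n : ℕ, 2 ≤ n → ∃ N : ℕ, n < N ∧ HasHyperbolicSeedOn 𝒪 N d) {n : ℕ} (hn : 2 ≤ n) (δ : weilNormResidueGroup d) :
    WeilClassesComponent n d δ :=
  weilClassesComponent_of_weilAlgebraicAll
    (weilAlgebraicAll_of_reach_of_localVariationalHodgeFor_of_cofinalHyperbolicSeedsOn_column hF hT hd hS hn) δ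

end AllLevels

/-! ## §2b The reading on a member: the WHOLE Weil plane of every Weil-type `(n, d)` pair (no polarization binder needed) -/

section MemberReading

variable {𝒪 : ObjClass} {n d : ℕ}

/-- **`WeilAlgebraicAll n d` read on a Weil-type member**: for every `(A, φ)` of Weil type `(n, d)` (van Geemen 4.9) the whole
complexified Weil plane is algebraic, `weilClassesOf A φ n d ≤ algebraicClasses A.X n` (the plane is rational of type `(n,n)` and ONE
non-zero algebraic class suffices — `weilClassesOf_le_algebraicClasses_iff_exists_ne_zero_of_dim_eq`; same three lines as
`MarkmanClassStatementComponent`'s member reading, without the Gram-placement binder). [cite: vanGeemen1994HodgeAV, 4.9–4.10 and Lemma 5.2 (5)–(6)] -/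
theorem weilClassesOf_le_algebraicClasses_of_weilAlgebraicAll_of_isWeilType (h : WeilAlgebraicAll n d) {A : AbelianVariety ℂ}
    {φ : A ⟶ A} (hA : IsWeilType A φ n d) : weilClassesOf A φ n d ≤ algebraicClasses A.X n := by
  obtain ⟨c, hcW, hc0, hcr⟩ := exists_isRationalClass_ne_zero_mem_weilClassesOf hA.pos hA.dim_eq hA.d_pos hA.sq_eq
  exact (weilClassesOf_le_algebraicClasses_iff_exists_ne_zero_of_dim_eq abelianVarietyCohomologyExteriorH1_holds hA.dim_eq
      hA.pos hA.d_pos hA.sq_eq).2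
    ⟨c, hcW, h A φ hA.dim_eq hA.sq_eq c hcW hcr (hA.isOfHodgeType_of_mem_weilClassesOf hcW), hc0⟩

/-- **Level 4 for `K = ℚ(√-d)`, read on a sixfold**: hyperbolic reach ∧ `LocalVariationalHodgeFor 𝒪` ∧ ONE level-4 hyperbolic seed for `d`
⟹ for EVERY `(A, φ)` of Weil type `(3, d)` — split or non-split — the whole Weil plane `weilClassesOf A φ 3 d ⊆ H⁶(A(ℂ); ℂ)` is
algebraic. OPEN in print off the split component; an implication only. [cite: Markman2025SurveySecant, §11.5 Step 2 (preprint)]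
[cite: WeilLocusSixfolds2026, p. 3 (status; preprint)] [cite: Schoen1998HodgeWeilAddendum, §10] -/
theorem weilClassesOf_sixfold_le_algebraicClasses_of_reach_of_localVariationalHodgeFor_of_hyperbolicSeedOn_four
    (hF : weilFamilyReach_hyperbolic) (hT : LocalVariationalHodgeFor 𝒪) (hd : 0 < d) (hS : HasHyperbolicSeedOn 𝒪 4 d)
    {A : AbelianVariety ℂ} {φ : A ⟶ A} (hA : IsWeilType A φ 3 d) : weilClassesOf A φ 3 d ≤ algebraicClasses A.X 3 :=
  weilClassesOf_le_algebraicClasses_of_weilAlgebraicAll_of_isWeilType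
    (weilAlgebraicAll_three_of_reach_of_localVariationalHodgeFor_of_hyperbolicSeedOn_four hF hT hd hS) hA

/-- **One column `K`, read on a member of any half-dimension `n ≥ 2`**: cofinal hyperbolic seeds for `d` ⟹ the whole Weil plane of
every `(A, φ)` of Weil type `(n, d)` is algebraic. [cite: Markman2025SurveySecant, §4 and §12 (preprint)] [cite: Schoen1998HodgeWeilAddendum, §10] -/
theorem weilClassesOf_le_algebraicClasses_of_reach_of_localVariationalHodgeFor_of_cofinalHyperbolicSeedsOn_column
    (hF : weilFamilyReach_hyperbolic) (hT : LocalVariationalHodgeFor 𝒪) (hd : 0 < d)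
    (hS : ∀ n : ℕ, 2 ≤ n → ∃ N : ℕ, n < N ∧ HasHyperbolicSeedOn 𝒪 N d) (hn : 2 ≤ n) {A : AbelianVariety ℂ} {φ : A ⟶ A}
    (hA : IsWeilType A φ n d) : weilClassesOf A φ n d ≤ algebraicClasses A.X n :=
  weilClassesOf_le_algebraicClasses_of_weilAlgebraicAll_of_isWeilType
    (weilAlgebraicAll_of_reach_of_localVariationalHodgeFor_of_cofinalHyperbolicSeedsOn_column hF hT hd hS hn) hA

end MemberReading

/-! ## §3 The same in the κ-shape currency (ONE anchor per `d`, unbundled) and on route (C)'s real carriers -/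

section KappaShape

variable {𝒪 : ObjClass}

/-- **Level 4, κ-shape form, every sixfold of ONE `K`**: hyperbolic reach and `LocalVariationalHodgeFor 𝒪` BY NAME; BY VALUE a split
`√-d`-Weil EIGHTFOLD anchor `(P, ψ₀, h)` in Markman's polarization (`ψ₀² = -d`, `ψ₀^*h = d·h`, `ι^*a = m·h`, hyperbolic for `h`), an
admissible object `𝒪 8 P.X I κ`, `4 ∈ I`, with `IsMarkmanKappaShape 4 d P ψ₀ h I κ w` (`κ₄ = q·h⁴ + w`, `w ≠ 0` rational Weil, `κ_p ∈
ℚ·hᵖ` on `I`) ⟹ `WeilAlgebraicAll 3 d` (instance `N = 4`, `n = 3` of `MarkmanClassStatementComponent`'s `…_isMarkmanKappaShape_lt`).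
No census row is claimed to supply such an object. [cite: Markman2025SurveySecant, §4 conditions (a)–(c) and §11.5 Step 2 (preprint)]
[cite: Markman2025SecantWeil, §1.3 and Cor. 1.3.2 (preprint)] [cite: Schoen1998HodgeWeilAddendum, §10] -/
theorem weilAlgebraicAll_three_of_reach_of_localVariationalHodgeFor_of_isMarkmanKappaShape_eightfold
    (hF : weilFamilyReach_hyperbolic) (hT : LocalVariationalHodgeFor 𝒪) {d : ℕ} (hd : 0 < d) (P : AbelianVariety ℂ)
    (ψ₀ : P ⟶ P) (ι : ProjectiveEmbedding P.X) (a : complexBetti (projectiveSpace ι.n ℂ) 2) (hP : P.dim = 2 * 4)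
    (hψ : ψ₀ ≫ ψ₀ = -(d • 𝟙 P)) (ha : IsRationalClass a) (ha0 : a ≠ 0) {h : complexBetti P.X 2} {m : ℚ} (hm : m ≠ 0)
    (hι : complexBetti.map ι.ι 2 a = ((m : ℚ) : ℂ) • h) (hψh : complexBetti.map ψ₀.hom.hom.hom 2 h = (d : ℂ) • h)
    (hhyp : IsHyperbolicWeilType P ψ₀ 4 h) {I : Finset ℕ} {κ : (p : ℕ) → complexBetti P.X (2 * p)}
    {w : complexBetti P.X (2 * 4)} (hS : IsMarkmanKappaShape 4 d P ψ₀ h I κ w) (h4I : 4 ∈ I) (h𝒪 : 𝒪 (2 * 4) P.X I κ) :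
    WeilAlgebraicAll 3 d :=
  weilAlgebraicAll_of_reach_of_localVariationalHodgeFor_of_isMarkmanKappaShape_lt hF hT hd P ψ₀ ι a hP hψ ha ha0 hm hι hψh hhyp
    hS h4I h𝒪 (by norm_num) (by norm_num)

/-- **… and every sixfold CELL `(3, K, δ)` of that `K`, the non-split ones included** (cell reading of the previous theorem; the
`g = 8`-row ⟹ `g = 6`-rows link of the census: a split eightfold object for `K` would settle every sixfold component of `K`).
[cite: Markman2025SurveySecant, §11.5 Step 2 (preprint)] [cite: Markman2025SecantWeil, §1.1 (preprint)] [cite: vanGeemen1994HodgeAV, 4.14 and Lemma 5.2] -/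
theorem weilSixfoldComponent_of_reach_of_localVariationalHodgeFor_of_isMarkmanKappaShape_eightfold
    (hF : weilFamilyReach_hyperbolic) (hT : LocalVariationalHodgeFor 𝒪) {d : ℕ} (hd : 0 < d) (P : AbelianVariety ℂ)
    (ψ₀ : P ⟶ P) (ι : ProjectiveEmbedding P.X) (a : complexBetti (projectiveSpace ι.n ℂ) 2) (hP : P.dim = 2 * 4)
    (hψ : ψ₀ ≫ ψ₀ = -(d • 𝟙 P)) (ha : IsRationalClass a) (ha0 : a ≠ 0) {h : complexBetti P.X 2} {m : ℚ} (hm : m ≠ 0)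
    (hι : complexBetti.map ι.ι 2 a = ((m : ℚ) : ℂ) • h) (hψh : complexBetti.map ψ₀.hom.hom.hom 2 h = (d : ℂ) • h)
    (hhyp : IsHyperbolicWeilType P ψ₀ 4 h) {I : Finset ℕ} {κ : (p : ℕ) → complexBetti P.X (2 * p)}
    {w : complexBetti P.X (2 * 4)} (hS : IsMarkmanKappaShape 4 d P ψ₀ h I κ w) (h4I : 4 ∈ I) (h𝒪 : 𝒪 (2 * 4) P.X I κ)
    (δ : weilNormResidueGroup d) : WeilClassesComponent 3 d δ :=
  weilClassesComponent_of_weilAlgebraicAll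
    (weilAlgebraicAll_three_of_reach_of_localVariationalHodgeFor_of_isMarkmanKappaShape_eightfold hF hT hd P ψ₀ ι a hP hψ ha
      ha0 hm hι hψh hhyp hS h4I h𝒪) δ

/-- **Cofinal levels, κ-shape form ⟹ R∞**: hyperbolic reach and `LocalVariationalHodgeFor 𝒪` BY NAME; for every `n ≥ 2` and `d`
SOME level `N > n` with a split `√-d`-Weil `2N`-fold anchor in the tree's symmetrised class carrying an admissible object of Markman's
class shape (the existential of `hasHyperbolicSeedOn_iff_exists_isMarkmanKappaShape`) ⟹ `WeilClassesImaginaryQuadratic`.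
[cite: Markman2025SurveySecant, §4 conditions (a)–(c) and §12 (preprint)] [cite: Schoen1998HodgeWeilAddendum, §10] [cite: Weil1977HodgeRing, §3] -/
theorem weilClassesImaginaryQuadratic_of_reach_of_localVariationalHodgeFor_of_cofinal_isMarkmanKappaShape
    (hF : weilFamilyReach_hyperbolic) (hT : LocalVariationalHodgeFor 𝒪)
    (hS : ∀ n : ℕ, 2 ≤ n → ∀ d : ℕ, 0 < d → ∃ (N : ℕ) (P : AbelianVariety ℂ) (ψ₀ : P ⟶ P) (ι : ProjectiveEmbedding P.X)
      (a : complexBetti (projectiveSpace ι.n ℂ) 2) (I : Finset ℕ) (κ : (p : ℕ) → complexBetti P.X (2 * p))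
      (w : complexBetti P.X (2 * N)),
      n < N ∧ P.dim = 2 * N ∧ ψ₀ ≫ ψ₀ = -(d • 𝟙 P) ∧ IsRationalClass a ∧ a ≠ 0 ∧
        IsHyperbolicWeilType P ψ₀ N (symmetrisedClass d P ψ₀ ι a) ∧
        IsMarkmanKappaShape N d P ψ₀ (symmetrisedClass d P ψ₀ ι a) I κ w ∧ N ∈ I ∧ 𝒪 (2 * N) P.X I κ) :
    WeilClassesImaginaryQuadratic :=
  weilClassesImaginaryQuadratic_of_reach_of_localVariationalHodgeFor_of_cofinalHyperbolicSeedsOn hF hT fun n hn d hd ↦ by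
    obtain ⟨N, P, ψ₀, ι, a, I, κ, w, hnN, hP, hψ, ha, ha0, hhyp, hκ, hNI, h𝒪⟩ := hS n hn d hd
    exact ⟨N, hnN, hκ.hasHyperbolicSeedOn P ψ₀ ι a hP hψ ha ha0 hhyp hNI h𝒪⟩

end KappaShape

section RouteC

open Literature.AlgebraicGeometry.KTheory

variable {C : ChernCharacterBetti}

/-- **Route (C), level 4 for every `K` ⟹ R1′ `NonsplitSixfolds`** — the census-row template for the `g = 8` → `g = 6` link on REAL
carriers: hyperbolic reach BY NAME; `PerfectComplexRankTransfer C` BY NAME (p4's ASSUMPTION for the real rank class `rankObjClass C`;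
printed strength on paper only — BF 2008 Prop. 6.4.4 for the rank leg, Pridham 2024 Cor. 2.25 / Rem. 2.27 + Perry 2022 Prop. 8.1 for
complexes; the kernel links `rankAdmissible` to none of them); ONE hyperbolic seed of class `rankObjClass C` on a split `√-d`-Weil
eightfold for every `d` (a rank-admissible bounded complex of vector bundles with `ch₄ = q·h⁴ + w`, by value). No row supplies it.
[cite: BuchweitzFlenner2008HH, Prop. 6.4.4] [cite: Markman2025SurveySecant, §11.5 Steps 1–2 and §12 (preprint)] [cite: Deligne1982HodgeCycles, proof of Thm. 4.8] -/
theorem nonsplitSixfolds_of_reach_of_perfectComplexRankTransfer_of_hyperbolicSeedsOn_four (hF : weilFamilyReach_hyperbolic)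
    (hT : PerfectComplexRankTransfer C) (hS : ∀ d : ℕ, 0 < d → HasHyperbolicSeedOn (rankObjClass C) 4 d) : NonsplitSixfolds :=
  nonsplitSixfolds_of_reach_of_localVariationalHodgeFor_of_hyperbolicSeedsOn_four hF hT.localVariationalHodgeFor hS

/-- **Route (C), level 4 for every `K` ⟹ R1 = stmt-2524 `SevenfoldWeilCensus.WeilSixfolds`** (same hypotheses).
[cite: BuchweitzFlenner2008HH, Prop. 6.4.4] [cite: Markman2025SurveySecant, §11.5 Step 2 (preprint)] [cite: Schoen1998HodgeWeilAddendum, §10] -/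
theorem weilSixfolds_of_reach_of_perfectComplexRankTransfer_of_hyperbolicSeedsOn_four (hF : weilFamilyReach_hyperbolic)
    (hT : PerfectComplexRankTransfer C) (hS : ∀ d : ℕ, 0 < d → HasHyperbolicSeedOn (rankObjClass C) 4 d) :
    Theses.SevenfoldWeilCensus.WeilSixfolds :=
  weilSixfolds_of_reach_of_localVariationalHodgeFor_of_hyperbolicSeedsOn_four hF hT.localVariationalHodgeFor hS

/-- **Route (C), one column `K = ℚ(√-d)`, level 4 ⟹ every sixfold cell of `K`** (`WeilClassesComponent 3 d δ`, all `δ`).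
[cite: BuchweitzFlenner2008HH, Prop. 6.4.4] [cite: Markman2025SurveySecant, §11.5 Step 2 (preprint)] [cite: vanGeemen1994HodgeAV, 4.14 and Lemma 5.2] -/
theorem weilSixfoldComponent_of_reach_of_perfectComplexRankTransfer_of_hyperbolicSeedOn_four (hF : weilFamilyReach_hyperbolic)
    (hT : PerfectComplexRankTransfer C) {d : ℕ} (hd : 0 < d) (hS : HasHyperbolicSeedOn (rankObjClass C) 4 d)
    (δ : weilNormResidueGroup d) : WeilClassesComponent 3 d δ :=
  weilSixfoldComponent_of_reach_of_localVariationalHodgeFor_of_hyperbolicSeedOn_four hF hT.localVariationalHodgeFor hd hS δ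

/-- **Route (C), cofinal levels ⟹ R∞** (same BY-NAME inputs; seeds of class `rankObjClass C` at cofinal levels for every `d`).
[cite: BuchweitzFlenner2008HH, Prop. 6.4.4] [cite: Markman2025SurveySecant, §4 and §12 (preprint)] [cite: Schoen1998HodgeWeilAddendum, §10] -/
theorem weilClassesImaginaryQuadratic_of_reach_of_perfectComplexRankTransfer_of_cofinalHyperbolicSeedsOn
    (hF : weilFamilyReach_hyperbolic) (hT : PerfectComplexRankTransfer C)
    (hS : ∀ n : ℕ, 2 ≤ n → ∀ d : ℕ, 0 < d → ∃ N : ℕ, n < N ∧ HasHyperbolicSeedOn (rankObjClass C) N d) :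
    WeilClassesImaginaryQuadratic :=
  weilClassesImaginaryQuadratic_of_reach_of_localVariationalHodgeFor_of_cofinalHyperbolicSeedsOn hF hT.localVariationalHodgeFor hS

end RouteC

/-! ## §4 The honest terminus: F1 and, modulo Moonen–Zarhin BY NAME, HC(dim ≤ 5) ([Mar25b] Thm. 1.2 / Cor. 1.3); NOT `HC_AV` -/

section Terminus

variable {𝒪 : ObjClass}

/-- **F1 — Markman's FOURFOLD statement `Markman2025_weilClasses_algebraic_abelianFourfold` ([Mar25b] Thm. 1.2, fourfold half: every
`K`, every discriminant — stated in print as the survey's theorem, proof in the preprint [Mar25] Thm. 1.5.1 + §1.6; refereed for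
`ℚ(√-3)` (Schoen) and `ℚ(i)` (Koike)) re-derived as an implication ⟸ hyperbolic reach ∧ `LocalVariationalHodgeFor 𝒪` ∧ ONE hyperbolic
seed of class `𝒪` on a split `√-d`-Weil SIXFOLD for every `d`** (the printed route: Thm. 1.5.1-type sixfold objects + §11.5 Step 2;
`MarkmanClassStatementComponent` §5 column by column). NOT a new case. [cite: Markman2025SurveySecant, Thm. 1.2 and §11.5 Step 2 (preprint)]
[cite: Markman2025SecantWeil, §1.6, proof of Cor. 1.6.1, first sentence (preprint)] [cite: Schoen1998HodgeWeilAddendum, §10] -/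
theorem floorFourfolds_of_reach_of_localVariationalHodgeFor_of_hyperbolicSeedsOn_three (hF : weilFamilyReach_hyperbolic)
    (hT : LocalVariationalHodgeFor 𝒪) (hS : ∀ d : ℕ, 0 < d → HasHyperbolicSeedOn 𝒪 3 d) :
    Markman2025_weilClasses_algebraic_abelianFourfold :=
  fun d hd A φ hA _ hφ c hc h22 hcW ↦
    weilAlgebraicAll_of_localVariationalHodgeFor_of_hyperbolicSeedOn_lt hF hT (hS d hd) (le_refl 2) (by norm_num) hd A φ hA hφ
      c hcW hc h22

/-- **[Mar25b] Cor. 1.3 AS PRINTED, as an implication: «The Hodge conjecture holds for abelian varieties of dimension `≤ 5`»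
(`SevenfoldWeilCensus.HodgeAbelianDimLeFive`, item stmt-HodgeConjecture-18723) ⟸ the Moonen–Zarhin reduction BY NAME
(`MoonenZarhin1999_hodgeClasses_abelian_dim_le_five_of_weilClassesFourfolds`: F1 ⟹ dim ≤ 5 — the combination printed in [Mar25b] §1.1 before
Cor. 1.3: Moonen–Zarhin 1999 Thms. 0.1–0.2, Moonen–Zarhin 1995, Ramón Marí, Tankeev; refereed inputs, the named fact is NOT proved in the tree)
∧ hyperbolic reach ∧ `LocalVariationalHodgeFor 𝒪` ∧ level-3 seeds for every `d`.**
[cite: Markman2025SurveySecant, Cor. 1.3 (preprint)] [cite: MoonenZarhin1999LowDim, Thm. 0.1 and Thm. 0.2] [cite: Schoen1998HodgeWeilAddendum, §10] -/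
theorem hodgeAbelianDimLeFive_of_moonenZarhin_of_reach_of_localVariationalHodgeFor_of_hyperbolicSeedsOn_three
    (hMZ : MoonenZarhin1999_hodgeClasses_abelian_dim_le_five_of_weilClassesFourfolds) (hF : weilFamilyReach_hyperbolic)
    (hT : LocalVariationalHodgeFor 𝒪) (hS : ∀ d : ℕ, 0 < d → HasHyperbolicSeedOn 𝒪 3 d) :
    Theses.SevenfoldWeilCensus.HodgeAbelianDimLeFive :=
  hMZ (floorFourfolds_of_reach_of_localVariationalHodgeFor_of_hyperbolicSeedsOn_three hF hT hS)

/-- **What cofinal levels give beyond R∞ in the tree: F1, R1 = stmt-2524, R1′, R2, and (Moonen–Zarhin BY NAME) HC(dim ≤ 5)** —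
the conjunction, for the «consequences» column. The CM-field rung `WeilClassesCMField` ([Mar25b] §12, `[K:ℚ] > 2`) and `HC_AV`
(`Ring2Transport.hodgeAbelianVarieties_iff_hodgeWeilType`: ALL Hodge classes of ALL Weil-type members) are NOT reached: the tree has no
descent edge over CM fields of degree `> 2` and no Weil-classes-to-`HC_AV` edge (André 1992 is for CM abelian varieties and needs all
CM fields). [cite: Markman2025SurveySecant, Thm. 1.2, Cor. 1.3 and §12 (preprint)] [cite: MoonenZarhin1999LowDim, Thm. 0.1 and Thm. 0.2]
[cite: Weil1977HodgeRing, §3] [cite: Markman2026ICMSecant, Thm. 1.2, Cor. 1.3 and §12 of the arXiv text (published ICM 2026 survey; results preprint)] -/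
theorem ladder_of_moonenZarhin_of_reach_of_localVariationalHodgeFor_of_cofinalHyperbolicSeedsOn
    (hMZ : MoonenZarhin1999_hodgeClasses_abelian_dim_le_five_of_weilClassesFourfolds) (hF : weilFamilyReach_hyperbolic)
    (hT : LocalVariationalHodgeFor 𝒪) (hS : ∀ n : ℕ, 2 ≤ n → ∀ d : ℕ, 0 < d → ∃ N : ℕ, n < N ∧ HasHyperbolicSeedOn 𝒪 N d) :
    WeilClassesImaginaryQuadratic ∧ Markman2025_weilClasses_algebraic_abelianFourfold ∧ Theses.SevenfoldWeilCensus.WeilSixfolds ∧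
      NonsplitSixfolds ∧ SplitWeilAbelianVarieties ∧ Theses.SevenfoldWeilCensus.HodgeAbelianDimLeFive := by
  have hR := weilClassesImaginaryQuadratic_of_reach_of_localVariationalHodgeFor_of_cofinalHyperbolicSeedsOn hF hT hS
  exact ⟨hR, floorFourfolds_of_weilClassesImaginaryQuadratic hR, weilSixfolds_of_weilClassesImaginaryQuadratic hR,
    nonsplitSixfolds_of_weilClassesImaginaryQuadratic hR, splitWeilAbelianVarieties_of_weilClassesImaginaryQuadratic hR,
    floorDimLeFive_of_weilClassesImaginaryQuadratic_of_moonenZarhin hMZ hR⟩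

end Terminus

/-! ## Audit: nothing is decided here
Every theorem above with a Weil / Hodge conclusion carries among its hypotheses hyperbolic SEEDS (`HasHyperbolicSeedOn 𝒪 N d` — the cell's
computation targets; in §3 unbundled into anchor ∧ `IsMarkmanKappaShape` ∧ object clause) AND the transfer statement for the same class
BY NAME (`LocalVariationalHodgeFor 𝒪`, or p4's `PerfectComplexRankTransfer C`), plus the refereed reach `weilFamilyReach_hyperbolic`;
§4 adds the Moonen–Zarhin reduction BY NAME. `HC_CM`, CM density, Mumford–Tate finiteness do not occur. No definition, no named fact. -/

end Summit.Ventures.HSemireg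

end
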